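import Summits.ResolutionOfSingularities.ResolutionOfSingularities.Theorems.MarkedTransferCampaignW46CuspStaircaseDichotomy
import Literature.AlgebraicGeometry.Resolution.PowerSeriesRegularLocal
import HarnessLib

/-!
# [OURS · L1 W4.6, rung (iii)] The cusp staircase — ring-level WITNESSES: K4.6's rows `y^p + xⁿ` as formal germs inhabit
# `CuspShape` / `CuspAt` / `MohWindowAt` (cell res-hironaka, LADDER-RESOLUTION rung L, D-0089; slot W4.6, seat res-L1-s46-pv-5;
# host route MarkedTransfer, `--supports stmt-ResolutionOfSingularities-16155 --as helper`)

HONEST FRAMING. Nothing here is a statement of H. Hironaka's manuscript (2017-03-23, [Hironaka2017]) and nothing here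
asserts that any statement of it holds. These are kernel NON-VACUITY witnesses, at the RING level, for the OURS predicates
of `Theorems/MarkedTransferCampaignW46MohWindow.lean` (`MohWindowAt`) and `…CuspStaircase.lean` (`CuspShape`, `CuspAt`,
`cuspIndex`), for the OURS desks (lane notes on desk #36 recorded «`MohWindowAt b R I` is EMPTY for `b ≤ 1`» and
hand-checked, not kernel-checked, inhabitants): in the formal plane `k⟦x, y⟧ = MvPowerSeries (Fin 2) k` over ANY field `k`
(regular local of dimension `2`, tree `isRegularLocalRing_mvPowerSeries_fin`, maximal ideal `(x, y)`,
`maximalIdeal_mvPowerSeries_eq_span`), the germ `(y^b + x^d)` is a cusp germ of exponents `(b, d)` for ALL `b, d`; it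
is `CuspAt b` whenever `b ∤ d` (K4.6's registered rows `p ∤ n`, read formally) with `cuspIndex ≤ d`, and a Moh-window
germ whenever `b < d < 2b`. What is NOT witnessed here: a scheme-level state `(𝔸²_K, ((y^p + xⁿ), p))` in
`Regime.cuspCurve` / `Regime.mohWindowCurve` (that needs `Sing = {origin}` on `Spec K[x, y]`, i.e. `ord < p` at every
other scheme point — not done). No FACT-LIST premise; no `sorry`; axioms standard. AI review is weaker than expert review.

## References

* `Theorems/MarkedTransferCampaignW46MohWindow.lean`, `…CuspStaircase*.lean` (this seat); L/res-L0-k46/KILL-TEST-K4.6.md §1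
  (the registered family `K_{p,n} = (y^p + xⁿ, p)`, `p ∤ n`).
* H. Matsumura, *Commutative Ring Theory*, §19 (formal power series rings are regular) — locator carried by the tree file
  `PowerSeriesRegularLocal.lean`. [Matsumura1987]
-/

noncomputable section

set_option linter.dupNamespace false -- mandated namespace of this single-conjunct summit

open IsLocalRing

namespace Summit.ResolutionOfSingularities.ResolutionOfSingularities.Theorems

namespace CampaignW46

open Literature.AlgebraicGeometry.Resolution

universe u

namespace Cusp

variable (k : Type u) [Field k]

/-- The maximal ideal of `k⟦x, y⟧` is `(x, y)` — as the pair `{X 0, X 1}`. [folklore] -/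
theorem span_X_pair_eq_maximalIdeal :
    Ideal.span {(MvPowerSeries.X 0 : MvPowerSeries (Fin 2) k), MvPowerSeries.X 1} =
      maximalIdeal (MvPowerSeries (Fin 2) k) := by
  rw [maximalIdeal_mvPowerSeries_eq_span k (Fin 2)]
  congr 1
  ext φ
  simp only [Set.mem_insert_iff, Set.mem_singleton_iff, Set.mem_range]
  constructor
  · rintro (rfl | rfl)
    exacts [⟨0, rfl⟩, ⟨1, rfl⟩]
  · rintro ⟨i, rfl⟩
    rcases Fin.exists_fin_two.mp ⟨i, rfl⟩ with h | h
    · exact Or.inl (by rw [h])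
    · exact Or.inr (by rw [h])

/-- `k⟦x, y⟧` has embedding dimension `2`. [cite: Matsumura1987, §19 p. 158] -/
theorem spanFinrank_maximalIdeal_powerSeries_two :
    (maximalIdeal (MvPowerSeries (Fin 2) k)).spanFinrank = 2 := by
  obtain ⟨hreg, hdim⟩ := isRegularLocalRing_mvPowerSeries_fin k 2
  haveI := hreg
  have h := IsRegularLocalRing.spanFinrank_maximalIdeal (R := MvPowerSeries (Fin 2) k)
  rw [hdim] at h
  exact_mod_cast h

/-- [OURS · L1 W4.6 rung (iii); NOT a statement of the manuscript] **Witness**: in `k⟦x, y⟧` over any field, the germ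
`(y^b + x^d)` is a cusp germ of exponents `(b, d)` (`CuspShape b d`), for all `b, d`. [folklore] -/
theorem cuspShape_powerSeries (b d : ℕ) :
    CuspShape b d (MvPowerSeries (Fin 2) k)
      (Ideal.span {(MvPowerSeries.X 1 : MvPowerSeries (Fin 2) k) ^ b + MvPowerSeries.X 0 ^ d}) :=
  ⟨(isRegularLocalRing_mvPowerSeries_fin k 2).1, spanFinrank_maximalIdeal_powerSeries_two k,
    MvPowerSeries.X 0, MvPowerSeries.X 1, span_X_pair_eq_maximalIdeal k, 1, isUnit_one, by rw [one_mul]⟩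

/-- [OURS · L1 W4.6 rung (iii); NOT a statement of the manuscript] **Witness for `CuspAt`**: for `b ∤ d` (K4.6's rows
`p ∤ n`, read formally) the germ `(y^b + x^d) ⊆ k⟦x, y⟧` is `CuspAt b`, with cusp index at most `d`. [folklore] -/
theorem cuspAt_powerSeries {b d : ℕ} (hnd : ¬ b ∣ d) :
    CuspAt b (MvPowerSeries (Fin 2) k)
        (Ideal.span {(MvPowerSeries.X 1 : MvPowerSeries (Fin 2) k) ^ b + MvPowerSeries.X 0 ^ d}) ∧
      cuspIndex b (MvPowerSeries (Fin 2) k)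
        (Ideal.span {(MvPowerSeries.X 1 : MvPowerSeries (Fin 2) k) ^ b + MvPowerSeries.X 0 ^ d}) ≤ d :=
  ⟨⟨d, hnd, cuspShape_powerSeries k b d⟩, cuspIndex_le hnd (cuspShape_powerSeries k b d)⟩

/-- [OURS · L1 W4.6 rung (iii); NOT a statement of the manuscript] **Witness for `MohWindowAt`**: for `b < d < 2b`
(K4.6's window rows `p < n < 2p`, read formally; non-empty as soon as `b ≥ 2`) the germ `(y^b + x^d) ⊆ k⟦x, y⟧` is a
Moh-window germ. [folklore] -/
theorem mohWindowAt_powerSeries {b d : ℕ} (hbd : b < d) (hd2 : d < 2 * b) :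
    MohWindowAt b (MvPowerSeries (Fin 2) k)
      (Ideal.span {(MvPowerSeries.X 1 : MvPowerSeries (Fin 2) k) ^ b + MvPowerSeries.X 0 ^ d}) :=
  ⟨(isRegularLocalRing_mvPowerSeries_fin k 2).1, spanFinrank_maximalIdeal_powerSeries_two k,
    MvPowerSeries.X 0, MvPowerSeries.X 1, span_X_pair_eq_maximalIdeal k, d, 1, isUnit_one, hbd, hd2, by rw [one_mul]⟩

/-- The two smallest instances, for the record: `y² + x³` (`p = 2`, `n = 3`: the only window row at `p = 2`) is a
Moh-window germ, and `y² + x⁵` (`n = 5 > 2p`: K4.6's first failing row) is `CuspAt 2` but lies outside the window range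
`b < d < 2b`. [folklore] -/
theorem witnesses_char_two :
    MohWindowAt 2 (MvPowerSeries (Fin 2) k)
        (Ideal.span {(MvPowerSeries.X 1 : MvPowerSeries (Fin 2) k) ^ 2 + MvPowerSeries.X 0 ^ 3}) ∧
      CuspAt 2 (MvPowerSeries (Fin 2) k)
        (Ideal.span {(MvPowerSeries.X 1 : MvPowerSeries (Fin 2) k) ^ 2 + MvPowerSeries.X 0 ^ 5}) ∧
      ¬ (2 < 5 ∧ 5 < 2 * 2) :=
  ⟨mohWindowAt_powerSeries k (by norm_num) (by norm_num), (cuspAt_powerSeries k (by norm_num)).1, by norm_num⟩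

end Cusp

end CampaignW46

end Summit.ResolutionOfSingularities.ResolutionOfSingularities.Theorems

end
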